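import Literature.Topology.FourManifolds.RegularLevelSplitting
import Literature.Topology.FourManifolds.MorseExistence
import Literature.Topology.FourManifolds.NiceMorseFunctions
import Literature.Topology.FourManifolds.Handles
import HarnessLib

/-!
# Splitting a closed manifold into two handlebodies at the regular level `i + 1/2`

Topic `Literature/Topology/FourManifolds` (trunk FourManL, notion `kirby_calculus_handles`);
serves the fact item `provefact-Literature.Symplectic.akbulut_matveyev`
(`Literature/Geometry/Symplectic/AkbulutMatveyev.lean`), whose printed proof starts from a
decomposition `X = X₁ ∪_∂ X₂` of a closed 4-manifold into the union `X₁` of its `0`-, `1`-,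
`2`-handles and the union `X₂` of its `3`-, `4`-handles (Akbulut–Matveyev 1998, §4, proof of
Cor. 1: "Consider arbitrary handle decomposition of `X` …"), and every statement of Kirby
calculus "up to 3- and 4-handles" (`SPC4Handles.lean`, (c)).  Everything in this file is
**proved**; it is a thin layer over `RegularLevelSplitting.lean` (regular sublevel and
superlevel sets of a function on a manifold without boundary as manifolds with boundary, their
Morse data, and the gluing `M = Mᵃ ∪_{f⁻¹(a)} M_a`).

**The statement formalised** (Milnor, *Lectures on the h-cobordism theorem* (1965), Thm. 4.8
with Def. 4.9 — a self-indexing Morse function — cut at the level `i + 1/2`, which is regular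
(§8: the levels `k + 1/2`), by Lemma 2.9 / Milnor, *Morse theory* (1963), Thm. 3.1
(`Mᵃ = f⁻¹(-∞, a]` is a smooth manifold with boundary `f⁻¹(a)`); the two pieces carry the
restricted, resp. the turned-about, Morse function, so that they are handlebodies with handles
of index `≤ i`, resp. `≤ dim - i - 1`, Milnor 1963, Thm. 3.2 and Milnor 1965, §3, proof of
Thm. 9.1 for the indices of `-f`):

* `Literature.Topology.FourManifolds.exists_handlebody_boundaryGluing_of_isSelfIndexing` — for a self-indexing Morse function
  `f` on a closed smooth manifold `M` modelled on `𝓡 (k + 1)` and `i + j = k`, `M` is the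
  gluing `A ∪_φ B` along the boundary (`Literature.Topology.FourManifolds.IsBoundaryGluing`, `Gluing.lean`) of the compact
  handlebody `A = f⁻¹(-∞, i + 1/2]` with handles of index `≤ i`
  (`Literature.IsHandlebodyOfIndexLE k i A`: the Morse function `f + (1/2 - i)` adapted to `∂A`) and
  the compact handlebody `B = f⁻¹[i + 1/2, ∞)` with handles of index `≤ j` (the Morse function
  `1 + (i + 1/2) - f`; at a critical point of `f` of index `λ ≥ i + 1` its index is
  `k + 1 - λ ≤ j`, `Literature.Topology.FourManifolds.IsMorse.morseIndex_const_sub_add`), `φ : ∂A ≅ ∂B` the identity of the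
  level `f⁻¹(i + 1/2)` (`RegularSublevel.isBoundaryGluing_split`);
* `Literature.Topology.FourManifolds.exists_handlebody_closedGluing_of_isSelfIndexing` — the same in the relational form
  `Literature.IsClosedGluing … R` with `R` relating boundary points only (the form consumed by
  `AkbulutMatveyev.lean`, `Literature.Geometry.Symplectic.IsBoundaryRelation`);
* `Literature.Topology.FourManifolds.exists_handlebody_closedGluing_of_rearrangement`,
  `Literature.Topology.FourManifolds.exists_twoHandlebody_closedGluing_of_rearrangement` — hence, from the named fact
  `Literature.exists_isSelfIndexing_criticalSet_eq (k + 1)` (Milnor 1965, Thm. 4.8;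
  `NiceMorseFunctions.lean`) and the proved existence of Morse functions
  (`Literature.Topology.FourManifolds.exists_isMorse_holds`, `MorseExistence.lean`), every closed smooth manifold splits
  in this way; in dimension `4` with `i = 2`, `j = 1`: *a closed smooth 4-manifold is a compact
  2-handlebody glued to a compact 1-handlebody (its 3- and 4-handles upside down) along their
  boundaries*.

## References

* J. Milnor, *Lectures on the h-cobordism theorem*, notes by L. Siebenmann and J. Sondow,
  Princeton (1965), Lemma 2.9 (p. 11 of the held copy), Thm. 4.8 and Def. 4.9 (p. 25), §8.
  [MilnorHCobordism1965]
* J. Milnor, *Morse theory*, Ann. of Math. Studies 51 (1963), §3, Thms. 3.1–3.2. [Milnor1963]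
* R. E. Gompf, A. I. Stipsicz, *4-manifolds and Kirby calculus*, GSM 20 (1999), §4.2, §4.4.
  [GompfStipsiczGSM1999]
* S. Akbulut, R. Matveyev, *A convex decomposition theorem for 4-manifolds*, IMRN 1998,
  no. 7, 371–381, §4. [AkbulutMatveyev1998]
-/

open scoped Manifold ContDiff Topology
open Set Function

noncomputable section

universe u

namespace Literature.Topology.FourManifolds

/-! ### The gluing relation of a gluing along the boundary -/

section Relation

variable {EM HM EN HN E₀ H₀ E₀' H₀' EP HP : Type*}
  [NormedAddCommGroup EM] [NormedSpace ℝ EM] [TopologicalSpace HM] {IM : ModelWithCorners ℝ EM HM}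
  [NormedAddCommGroup EN] [NormedSpace ℝ EN] [TopologicalSpace HN] {IN : ModelWithCorners ℝ EN HN}
  [NormedAddCommGroup E₀] [NormedSpace ℝ E₀] [TopologicalSpace H₀] {I₀ : ModelWithCorners ℝ E₀ H₀}
  [NormedAddCommGroup E₀'] [NormedSpace ℝ E₀'] [TopologicalSpace H₀']
  {I₀' : ModelWithCorners ℝ E₀' H₀'}
  [NormedAddCommGroup EP] [NormedSpace ℝ EP] [TopologicalSpace HP]
  {M : Type u} [TopologicalSpace M] [ChartedSpace HM M]
  {N : Type u} [TopologicalSpace N] [ChartedSpace HN N]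
  {bM : BoundaryData IM M I₀} {bN : BoundaryData IN N I₀'} {IP : ModelWithCorners ℝ EP HP}
  {P : Type*} [TopologicalSpace P] [ChartedSpace HP P]

/-- The gluing relation "`x = incl z` and `y = incl (φ z)`" of a gluing along the boundary
relates boundary points to boundary points only. [folklore] -/
theorem isBoundaryPoint_of_boundaryGluingRel (φ : bM.carrier → bN.carrier) {x : M} {y : N}
    (hxy : ∃ z, x = bM.incl z ∧ y = bN.incl (φ z)) :
    IM.IsBoundaryPoint x ∧ IN.IsBoundaryPoint y := by
  obtain ⟨z, rfl, rfl⟩ := hxy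
  exact ⟨bM.incl_mem_boundary z, bN.incl_mem_boundary (φ z)⟩

end Relation

/-! ### Splitting a closed manifold into two handlebodies -/

section Splitting

variable {k : ℕ}

/-- The levels `i + 1/2` are not integers (Milnor 1965, §8: for a self-indexing Morse
function the levels `k + 1/2` are regular). [folklore] -/
theorem natCast_ne_add_half (n i : ℕ) : (n : ℝ) ≠ i + 1 / 2 := by
  intro h
  have h2 : ((2 * n : ℕ) : ℝ) = ((2 * i + 1 : ℕ) : ℝ) := by push_cast; rw [h]; ring
  have h3 : 2 * n = 2 * i + 1 := by exact_mod_cast h2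
  omega

/-- For a self-indexing function, the level `i + 1/2` passes through no critical point.
[cite: MilnorHCobordism1965, §8 (the levels k + 1/2)] -/
theorem IsSelfIndexing.apply_ne_add_half {E H : Type*} [NormedAddCommGroup E] [NormedSpace ℝ E]
    [TopologicalSpace H] {I : ModelWithCorners ℝ E H} {N : Type*} [TopologicalSpace N]
    [ChartedSpace H N] {f : N → ℝ} (hf : IsSelfIndexing I f) (i : ℕ) {z : N}
    (hz : IsMCriticalPt I f z) : f z ≠ i + 1 / 2 := by
  obtain ⟨n, -, hn⟩ := hf.exists_nat_apply_eq hz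
  rw [hn]; exact natCast_ne_add_half n i

variable (M : Type u) [TopologicalSpace M] [T2Space M] [SecondCountableTopology M]
  [CompactSpace M] [ChartedSpace (EuclideanSpace ℝ (Fin (k + 1))) M] [IsManifold (𝓡 (k + 1)) ∞ M]

/-- **Splitting a closed manifold into two handlebodies, boundary-gluing form** (Milnor,
*Lectures on the h-cobordism theorem* (1965), Lemma 2.9 with Thm. 4.8/Def. 4.9 and §8;
Milnor, *Morse theory* (1963), Thms. 3.1–3.2; the mechanism of "`X =` (`0`-, …, `i`-handles)
`∪_∂` (the remaining handles, turned upside down)", Gompf–Stipsicz (1999), §4.2/§4.4,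
Akbulut–Matveyev (1998), §4).  Let `f` be a self-indexing Morse function on the closed smooth
manifold `M` (model `𝓡 (k + 1)`) and `i + j = k`.  Then `M` is the gluing along the boundary
(`Literature.Topology.FourManifolds.IsBoundaryGluing`) of the compact smooth manifolds with boundary
`A = f⁻¹(-∞, i + 1/2]` and `B = f⁻¹[i + 1/2, ∞)` (`Literature.Topology.FourManifolds.RegularSublevel`,
`Literature.Topology.FourManifolds.RegularSuperlevel`) along the identification of their common boundary `f⁻¹(i + 1/2)`;
`A` is a handlebody with handles of index `≤ i` (it carries the Morse function
`f + (1/2 - i)` adapted to `∂A`, whose critical points are those of `f` of index `≤ i`) and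
`B` one with handles of index `≤ j` (it carries `1 + (i + 1/2) - f`, whose critical points
are those of `f` of index `λ ≥ i + 1`, with index `k + 1 - λ ≤ j`).
[cite: MilnorHCobordism1965, Lemma 2.9 and Thm. 4.8] -/
theorem exists_handlebody_boundaryGluing_of_isSelfIndexing {f : M → ℝ}
    (hf : IsMorse (𝓡 (k + 1)) f) (hsi : IsSelfIndexing (𝓡 (k + 1)) f) (i j : ℕ)
    (hij : i + j = k) :
    ∃ (A B : Type u) (_ : TopologicalSpace A) (_ : T2Space A) (_ : SecondCountableTopology A)
      (_ : CompactSpace A) (_ : ChartedSpace (EuclideanHalfSpace (k + 1)) A)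
      (_ : IsManifold (𝓡∂ (k + 1)) ∞ A)
      (_ : TopologicalSpace B) (_ : T2Space B) (_ : SecondCountableTopology B)
      (_ : CompactSpace B) (_ : ChartedSpace (EuclideanHalfSpace (k + 1)) B)
      (_ : IsManifold (𝓡∂ (k + 1)) ∞ B)
      (bA : BoundaryData (𝓡∂ (k + 1)) A (𝓡 k)) (bB : BoundaryData (𝓡∂ (k + 1)) B (𝓡 k))
      (φ : bA.carrier ≃ₘ⟮𝓡 k, 𝓡 k⟯ bB.carrier),
      IsHandlebodyOfIndexLE k i A ∧ IsHandlebodyOfIndexLE k j B ∧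
        IsBoundaryGluing bA bB φ (𝓡 (k + 1)) M := by
  set a : ℝ := i + 1 / 2 with ha
  have hfd : ∀ z, MDifferentiableAt (𝓡 (k + 1)) 𝓘(ℝ, ℝ) f z := fun z =>
    hf.contMDiff.mdifferentiableAt (by simp)
  -- `a` is a regular level of `f`
  have hreg : ∀ z, IsMCriticalPt (𝓡 (k + 1)) f z → f z ≠ a := fun z hz =>
    hsi.apply_ne_add_half i hz
  have h : IsRegularLevel (𝓡 (k + 1)) f a := hf.isRegularLevel hreg
  -- the turned-about function presenting the superlevel set
  have hg : IsMorse (𝓡 (k + 1)) (fun y => a - f y) := hf.const_sub a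
  obtain ⟨hadA, hcritA, hindA⟩ := RegularSublevel.morseData hf h
  obtain ⟨hadB, hcritB, hindB⟩ := RegularSublevel.morseData hg h.const_sub
  refine ⟨RegularSublevel h, RegularSuperlevel h, inferInstance, inferInstance, inferInstance,
    inferInstance, inferInstance, inferInstance, inferInstance, inferInstance, inferInstance,
    inferInstance, inferInstance, inferInstance, RegularSublevel.boundaryData h,
    RegularSublevel.boundaryData h.const_sub, RegularSublevel.splitDiffeomorph h, ?_, ?_,
    RegularSublevel.isBoundaryGluing_split h⟩
  · -- `A = {f ≤ i + 1/2}` is a handlebody with handles of index `≤ i`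
    refine ⟨_, hadA, fun z hz => ?_⟩
    have hz' : IsMCriticalPt (𝓡 (k + 1)) f (RegularSublevel.incl h z) := (hcritA z).1 hz
    rw [hindA z hz']
    have hle : f (RegularSublevel.incl h z) ≤ a := RegularSublevel.apply_incl_le h z
    have hle2 : (morseIndex (𝓡 (k + 1)) f (RegularSublevel.incl h z) : ℝ) ≤ (i : ℝ) + 1 / 2 := by
      rw [← hsi _ hz']; exact hle
    have h2 : (morseIndex (𝓡 (k + 1)) f (RegularSublevel.incl h z) : ℝ) < (i : ℝ) + 1 := by
      linarith
    have h3 : morseIndex (𝓡 (k + 1)) f (RegularSublevel.incl h z) < i + 1 := by exact_mod_cast h2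
    omega
  · -- `B = {i + 1/2 ≤ f}` is a handlebody with handles of index `≤ j`
    refine ⟨_, hadB, fun z hz => ?_⟩
    set x := RegularSublevel.incl h.const_sub z with hx
    have hz' : IsMCriticalPt (𝓡 (k + 1)) (fun y => a - f y) x := (hcritB z).1 hz
    have hzf : IsMCriticalPt (𝓡 (k + 1)) f x := (isMCriticalPt_const_sub_iff a (hfd x)).1 hz'
    rw [hindB z hz', ← hx]
    have hsum : morseIndex (𝓡 (k + 1)) (fun y => a - f y) x + morseIndex (𝓡 (k + 1)) f x =
        k + 1 := by
      simpa [finrank_euclideanSpace_fin] using hf.morseIndex_const_sub_add a hzf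
    have hle : a - f x ≤ 0 := RegularSublevel.apply_incl_le h.const_sub z
    have hle2 : (i : ℝ) + 1 / 2 ≤ (morseIndex (𝓡 (k + 1)) f x : ℝ) := by
      rw [← hsi _ hzf]; linarith
    have h2 : (i : ℝ) < morseIndex (𝓡 (k + 1)) f x := by linarith
    have h3 : i < morseIndex (𝓡 (k + 1)) f x := by exact_mod_cast h2
    omega

/-- **Splitting a closed manifold into two handlebodies, relational form**: under the same
hypotheses, `M` is a closed gluing (`Literature.Topology.FourManifolds.IsClosedGluing`: two smooth embeddings with covering
ranges, meeting exactly along the relation) of a compact handlebody `A` with handles of index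
`≤ i` and a compact handlebody `B` with handles of index `≤ j` along a relation `R` which only
relates boundary points of `A` to boundary points of `B` (the form consumed in
`Literature/Geometry/Symplectic/AkbulutMatveyev.lean`). [cite: MilnorHCobordism1965, Lemma 2.9 and Thm. 4.8] -/
theorem exists_handlebody_closedGluing_of_isSelfIndexing {f : M → ℝ}
    (hf : IsMorse (𝓡 (k + 1)) f) (hsi : IsSelfIndexing (𝓡 (k + 1)) f) (i j : ℕ)
    (hij : i + j = k) :
    ∃ (A B : Type u) (_ : TopologicalSpace A) (_ : T2Space A) (_ : SecondCountableTopology A)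
      (_ : CompactSpace A) (_ : ChartedSpace (EuclideanHalfSpace (k + 1)) A)
      (_ : IsManifold (𝓡∂ (k + 1)) ∞ A)
      (_ : TopologicalSpace B) (_ : T2Space B) (_ : SecondCountableTopology B)
      (_ : CompactSpace B) (_ : ChartedSpace (EuclideanHalfSpace (k + 1)) B)
      (_ : IsManifold (𝓡∂ (k + 1)) ∞ B) (R : A → B → Prop),
      IsHandlebodyOfIndexLE k i A ∧ IsHandlebodyOfIndexLE k j B ∧
        (∀ x y, R x y → (𝓡∂ (k + 1)).IsBoundaryPoint x ∧ (𝓡∂ (k + 1)).IsBoundaryPoint y) ∧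
        IsClosedGluing (𝓡∂ (k + 1)) (𝓡∂ (k + 1)) (𝓡 (k + 1)) (P := M) R := by
  obtain ⟨A, B, _, _, _, hcA, _, hmA, _, _, _, hcB, _, hmB, bA, bB, φ, hA, hB, hglue⟩ :=
    exists_handlebody_boundaryGluing_of_isSelfIndexing M hf hsi i j hij
  exact ⟨A, B, _, inferInstance, inferInstance, hcA, _, hmA, _, inferInstance, inferInstance,
    hcB, _, hmB, fun x y => ∃ z, x = bA.incl z ∧ y = bB.incl (φ z), hA, hB,
    fun x y hxy => isBoundaryPoint_of_boundaryGluingRel φ hxy, hglue.isClosedGluing⟩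

/-- **Every closed smooth manifold splits into two handlebodies, given Milnor's final
rearrangement theorem.**  From the tree's named fact
`Literature.exists_isSelfIndexing_criticalSet_eq (k + 1)` (Milnor 1965, Thm. 4.8: self-indexing
rearrangement of a Morse function) and the proved existence of Morse functions on closed
manifolds (`Literature.Topology.FourManifolds.exists_isMorse_holds`, `MorseExistence.lean`), every closed smooth
manifold `M` modelled on `𝓡 (k + 1)` is, for `i + j = k`, a closed gluing along a boundary
relation of a compact handlebody with handles of index `≤ i` and a compact handlebody with
handles of index `≤ j`. [cite: MilnorHCobordism1965, Thm. 4.8 and Lemma 2.9] -/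
theorem exists_handlebody_closedGluing_of_rearrangement
    (hR : exists_isSelfIndexing_criticalSet_eq.{u} (k + 1)) (i j : ℕ) (hij : i + j = k) :
    ∃ (A B : Type u) (_ : TopologicalSpace A) (_ : T2Space A) (_ : SecondCountableTopology A)
      (_ : CompactSpace A) (_ : ChartedSpace (EuclideanHalfSpace (k + 1)) A)
      (_ : IsManifold (𝓡∂ (k + 1)) ∞ A)
      (_ : TopologicalSpace B) (_ : T2Space B) (_ : SecondCountableTopology B)
      (_ : CompactSpace B) (_ : ChartedSpace (EuclideanHalfSpace (k + 1)) B)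
      (_ : IsManifold (𝓡∂ (k + 1)) ∞ B) (R : A → B → Prop),
      IsHandlebodyOfIndexLE k i A ∧ IsHandlebodyOfIndexLE k j B ∧
        (∀ x y, R x y → (𝓡∂ (k + 1)).IsBoundaryPoint x ∧ (𝓡∂ (k + 1)).IsBoundaryPoint y) ∧
        IsClosedGluing (𝓡∂ (k + 1)) (𝓡∂ (k + 1)) (𝓡 (k + 1)) (P := M) R := by
  obtain ⟨f₀, hf₀⟩ := FourManifolds.exists_isMorse_holds (k + 1) M
  obtain ⟨f, hf, hsi, -, -⟩ := hR M f₀ hf₀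
  exact exists_handlebody_closedGluing_of_isSelfIndexing M hf hsi i j hij

/-- **Dimension four: a closed smooth 4-manifold is a 2-handlebody glued to an upside-down
1-handlebody**, given Milnor's rearrangement theorem in dimension `4` — the decomposition
"`X₁ =` `0`-, `1`-, `2`-handles, `X₂ =` `3`-, `4`-handles" of Kirby calculus (Gompf–Stipsicz
1999, §4.4) and of Akbulut–Matveyev (1998), §4. [cite: MilnorHCobordism1965, Thm. 4.8 and Lemma 2.9] -/
theorem exists_twoHandlebody_closedGluing_of_rearrangement
    (hR : exists_isSelfIndexing_criticalSet_eq.{u} 4) (X : Type u) [TopologicalSpace X]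
    [T2Space X] [SecondCountableTopology X] [CompactSpace X]
    [ChartedSpace (EuclideanSpace ℝ (Fin 4)) X] [IsManifold (𝓡 4) ∞ X] :
    ∃ (A B : Type u) (_ : TopologicalSpace A) (_ : T2Space A) (_ : SecondCountableTopology A)
      (_ : CompactSpace A) (_ : ChartedSpace (EuclideanHalfSpace 4) A)
      (_ : IsManifold (𝓡∂ 4) ∞ A)
      (_ : TopologicalSpace B) (_ : T2Space B) (_ : SecondCountableTopology B)
      (_ : CompactSpace B) (_ : ChartedSpace (EuclideanHalfSpace 4) B) (_ : IsManifold (𝓡∂ 4) ∞ B)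
      (R : A → B → Prop),
      IsHandlebodyOfIndexLE 3 2 A ∧ IsHandlebodyOfIndexLE 3 1 B ∧
        (∀ x y, R x y → (𝓡∂ 4).IsBoundaryPoint x ∧ (𝓡∂ 4).IsBoundaryPoint y) ∧
        IsClosedGluing (𝓡∂ 4) (𝓡∂ 4) (𝓡 4) (P := X) R :=
  exists_handlebody_closedGluing_of_rearrangement (k := 3) X hR 2 1 rfl

end Splitting

end Literature.Topology.FourManifolds
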